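import Summits.AtomisticToContinuum.Crystallization.Theorems.LoopTunnelDialForcePricing

/-!
# LoopTunnelDial — FORCE PRICING, part B: the CLIQUE-CELL DUAL CERTIFICATE format `CellCert`, its soundness, and the two-piece path (kit 14B)
(lens-5 generation 26; crux `PocketCase`, stmt-AtomisticToContinuum-27294; stub 3 HOT = `ContactHotAbove (3/4)`.)

Part A (`LoopTunnelDialForcePricing`) proved HOT ⟸ `PricedLoadCap (3/4) c Λ`, `Λ < m(c) + 0.711` ⟸ `FinPricedLoadCap` + certified tails.  This part
types the CERTIFICATE FORMAT census must output (critic row 349 (4)) and proves its soundness: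
§4 `CellCert` = cells covering the admissible region about `(x, q)`, weight majorants, CLIQUES (cell families of joint diameter `< 7/10`, hence
   holding at most one point of a `7/10`-separated set — no packing theorem), a dual vector `y ≥ 0` with `wt i ≤ ∑_{K ∋ i} y_K`; soundness
   `CellCert.sum_le : ∑_{z ∈ T} w z ≤ ∑_K y_K` by double counting; `finPricedLoadCap_of_certs`; `contactHotAbove_threeQuarters_of_certs5`.
   CHECKER SKELETON: C1 cover · C2 majorant (interval lemma per cell) · C3 clique diameter · C4 dual feasibility · C5 sign — C3–C5 rational rows.
§5 the two-piece path of row 343 in the same format: `FinShellLoad` / `FinShellForce` (isotropic `|V|`, `|g|` on a shell, `q := x`), the splice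
   `farTails_of_shellCerts : FinShellLoad r₁ R E → FinShellForce r₁ R F → FarTails R E' F' → FarTails r₁ (E+E') (F+F')` and the composed reach
   `contactHotAbove_threeQuarters_of_near_shellCerts` (near `FinContactHot` at a branch-and-bound radius + far load/force certificates + shell tails ⟹ HOT).

Every `def` below is line vocabulary of the LoopTunnelDial contact dial (crux stmt-AtomisticToContinuum-27294), not a cited fact.  0 sorry.
-/

noncomputable section

namespace Summit.AtomisticToContinuum.Crystallization.Theorems.LoopTunnelDialForcePricing

open scoped BigOperators Classical InnerProductSpace
open Literature.MathematicalPhysics.StatisticalMechanics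
open Summit.AtomisticToContinuum.Crystallization.Theorems.GrainPercolationDialCrossCeiling (E3 ballChunk)
open Summit.AtomisticToContinuum.Crystallization.Theorems.ChargedEnergyGapNegative (eStar)
open Summit.AtomisticToContinuum.Crystallization.Theorems.LoopTunnelDialContactLaw
open Summit.AtomisticToContinuum.Crystallization.Theorems.LoopTunnelDialRangeTails
open Summit.AtomisticToContinuum.Crystallization.Theorems.LoopTunnelDialShellTail
open Summit.AtomisticToContinuum.Crystallization.Theorems.LoopTunnelDialFinContact
open Summit.AtomisticToContinuum.Crystallization.Theorems.LoopTunnelDialFinPushLoad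

variable {N : ℕ}

/-! ### §4 The CLIQUE-CELL DUAL CERTIFICATE format and its soundness (PROVED) -/

/-- **`CellCert` — THE CERTIFICATE FORMAT for a one-centre weighted hard-core bound** (what census's I-CAP / TAG 129 must output).
`cells` indexes finitely many regions `cell i ⊂ ℝ³`, `wt i` is a certified majorant of the weight on `cell i`, `cliques` lists cell families
whose union has diameter `< 7/10`, and `y` is the LP-dual vector on the cliques.  The certified bound is `bound = ∑_{K ∈ cliques} y K`. [line vocabulary · LoopTunnelDial contact dial · crux stmt-AtomisticToContinuum-27294 · definition, not a cited fact] -/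
structure CellCert where
  /-- the finite index set of cells -/
  cells : Finset ℕ
  /-- the cells (regions of `ℝ³`; in practice rational boxes in a frame at `(x, q)`) -/
  cell : ℕ → Set E3
  /-- certified weight majorants per cell (check C2) -/
  wt : ℕ → ℝ
  /-- the cliques: cell families whose union has diameter `< 7/10` (check C3) -/
  cliques : Finset (Finset ℕ)
  /-- the dual vector on the cliques (checks C4, C5) -/
  y : Finset ℕ → ℝ

/-- The certified bound `∑_K y_K` of a certificate. [line vocabulary · LoopTunnelDial contact dial · crux stmt-AtomisticToContinuum-27294 · definition, not a cited fact] -/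
def CellCert.bound (C : CellCert) : ℝ := ∑ K ∈ C.cliques, C.y K

/-- The ADMISSIBLE REGION about the pair `(x, q)` at range `R`: `7/10 ≤ |z − x| ≤ R` and `|z − q| ≥ 7/10`. [line vocabulary · LoopTunnelDial contact dial · crux stmt-AtomisticToContinuum-27294 · definition, not a cited fact] -/
def Admissible (x q : E3) (R : ℝ) (z : E3) : Prop := (7 : ℝ) / 10 ≤ dist x z ∧ dist x z ≤ R ∧ (7 : ℝ) / 10 ≤ dist q z

/-- **`CellCert.Valid C x q R w` — THE FIVE CHECKS.**  C1 COVER: every admissible `z` lies in some cell; C2 MAJORANT: `w z ≤ wt i` for admissible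
`z ∈ cell i`; C3 CLIQUE: any two points of cells of one clique are `< 7/10` apart; C4 DUAL FEASIBILITY: `wt i ≤ ∑_{K ∋ i} y K`; C5 (sign) `y ≥ 0`.
(The numeric comparison `bound ≤ Λ₀` is kept outside.) [line vocabulary · LoopTunnelDial contact dial · crux stmt-AtomisticToContinuum-27294 · definition, not a cited fact] -/
def CellCert.Valid (C : CellCert) (x q : E3) (R : ℝ) (w : E3 → ℝ) : Prop :=
  (∀ z : E3, Admissible x q R z → ∃ i ∈ C.cells, z ∈ C.cell i) ∧
  (∀ i ∈ C.cells, ∀ z ∈ C.cell i, Admissible x q R z → w z ≤ C.wt i) ∧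
  (∀ K ∈ C.cliques, ∀ i ∈ K, ∀ j ∈ K, ∀ z ∈ C.cell i, ∀ z' ∈ C.cell j, dist z z' < 7 / 10) ∧
  (∀ i ∈ C.cells, C.wt i ≤ ∑ K ∈ C.cliques.filter (fun K => i ∈ K), C.y K) ∧
  (∀ K ∈ C.cliques, 0 ≤ C.y K)

/-- A clique holds at most one point of a `7/10`-separated set (C3; no packing theorem involved). -/
theorem card_filter_clique_le_one (C : CellCert) {x q : E3} {R : ℝ} {w : E3 → ℝ} (hV : C.Valid x q R w) {K : Finset ℕ} (hK : K ∈ C.cliques)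
    (T : Finset E3) (hsep : ∀ z ∈ T, ∀ z' ∈ T, z ≠ z' → (7 : ℝ) / 10 ≤ dist z z') (f : E3 → ℕ)
    (hf : ∀ z ∈ T, z ∈ C.cell (f z)) :
    (T.filter (fun z => f z ∈ K)).card ≤ 1 := by
  rw [Finset.card_le_one]
  intro z hz z' hz'
  rw [Finset.mem_filter] at hz hz'
  by_contra hne
  have h1 := hV.2.2.1 K hK (f z) hz.2 (f z') hz'.2 z (hf z hz.1) z' (hf z' hz'.1)
  have h2 := hsep z hz.1 z' hz'.1 hne
  linarith

/-- **SOUNDNESS OF THE CERTIFICATE (PROVED, double counting):** for a valid certificate about `(x, q)` and every `7/10`-separated finite `T`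
inside the admissible region, `∑_{z ∈ T} w z ≤ bound`.  Chain: `w z ≤ wt (cell of z) ≤ ∑_{K ∋ cell of z} y K`; swapping the sums, each clique is
charged `y K × #(T-points in its cells) ≤ y K`. -/
theorem CellCert.sum_le (C : CellCert) {x q : E3} {R : ℝ} {w : E3 → ℝ} (hV : C.Valid x q R w) (T : Finset E3)
    (hT : ∀ z ∈ T, Admissible x q R z) (hsep : ∀ z ∈ T, ∀ z' ∈ T, z ≠ z' → (7 : ℝ) / 10 ≤ dist z z') :
    ∑ z ∈ T, w z ≤ C.bound := by
  obtain ⟨hcover, hwt, hcl, hdual, hy⟩ := hV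
  -- choose a cell for every point of T
  have hch : ∀ z : E3, ∃ i : ℕ, z ∈ T → i ∈ C.cells ∧ z ∈ C.cell i := by
    intro z
    by_cases hz : z ∈ T
    · obtain ⟨i, hi, hzi⟩ := hcover z (hT z hz)
      exact ⟨i, fun _ => ⟨hi, hzi⟩⟩
    · exact ⟨0, fun h => absurd h hz⟩
  choose f hf using hch
  -- step 1: pointwise majorant and dual feasibility
  have h1 : ∑ z ∈ T, w z ≤ ∑ z ∈ T, ∑ K ∈ C.cliques.filter (fun K => f z ∈ K), C.y K := by
    refine Finset.sum_le_sum fun z hz => ?_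
    exact (hwt (f z) (hf z hz).1 z (hf z hz).2 (hT z hz)).trans (hdual (f z) (hf z hz).1)
  -- step 2: swap the sums
  have h2 : ∑ z ∈ T, ∑ K ∈ C.cliques.filter (fun K => f z ∈ K), C.y K =
      ∑ K ∈ C.cliques, C.y K * ((T.filter (fun z => f z ∈ K)).card : ℝ) := by
    simp_rw [Finset.sum_filter]
    rw [Finset.sum_comm]
    refine Finset.sum_congr rfl fun K _ => ?_
    rw [← Finset.sum_filter, Finset.sum_const, nsmul_eq_mul, mul_comm]
  -- step 3: each clique is charged at most once
  have h3 : ∑ K ∈ C.cliques, C.y K * ((T.filter (fun z => f z ∈ K)).card : ℝ) ≤ ∑ K ∈ C.cliques, C.y K := by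
    refine Finset.sum_le_sum fun K hK => ?_
    have hc : ((T.filter (fun z => f z ∈ K)).card : ℝ) ≤ 1 := by
      exact_mod_cast card_filter_clique_le_one C ⟨hcover, hwt, hcl, hdual, hy⟩ hK T hsep f (fun z hz => (hf z hz).2)
    have := mul_le_mul_of_nonneg_left hc (hy K hK)
    simpa using this
  unfold CellCert.bound
  linarith [h1, h2.le, h2.ge, h3]

/-- The EMPTY certificate (no cells, no cliques, bound `0`). [line vocabulary · LoopTunnelDial contact dial · crux stmt-AtomisticToContinuum-27294 · definition, not a cited fact] -/
def CellCert.empty : CellCert := ⟨∅, fun _ => ∅, fun _ => 0, ∅, fun _ => 0⟩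

/-- FORMAT SANITY (PROVED): below range `7/10` the admissible region is empty and the empty certificate is valid for every weight. -/
theorem CellCert.empty_valid {x q : E3} {R : ℝ} (hR : R < 7 / 10) (w : E3 → ℝ) : CellCert.empty.Valid x q R w := by
  refine ⟨?_, ?_, ?_, ?_, ?_⟩
  · rintro z ⟨h1, h2, -⟩
    exact absurd (h1.trans h2) (not_le.2 hR)
  · intro i hi; simp [CellCert.empty] at hi
  · intro K hK; simp [CellCert.empty] at hK
  · intro i hi; simp [CellCert.empty] at hi
  · intro K hK; simp [CellCert.empty] at hK

/-- The empty certificate certifies `0`. -/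
theorem CellCert.empty_bound : CellCert.empty.bound = 0 := by
  simp [CellCert.bound, CellCert.empty]

/-- The points of `(s ∖ {x}) ∖ {q}` of an `R`-truncated `7/10`-separated point set are admissible about `(x, q)`. -/
theorem admissible_of_mem {s : Finset E3} {x q : E3} {R : ℝ} (hx : x ∈ s) (hq : q ∈ s) (hR : ∀ z ∈ s, dist x z ≤ R)
    (hsep : ∀ z ∈ s, ∀ w ∈ s, z ≠ w → (7 : ℝ) / 10 ≤ dist z w) {z : E3} (hz : z ∈ (s.erase x).erase q) : Admissible x q R z := by
  obtain ⟨hzq, hz'⟩ := Finset.mem_erase.1 hz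
  obtain ⟨hzx, hzs⟩ := Finset.mem_erase.1 hz'
  exact ⟨hsep x hx z hzs (Ne.symm hzx), hR z hzs, hsep q hq z hzs (Ne.symm hzq)⟩

/-- **THE FINITE PRICED CAPACITY FROM A UNIFORM FAMILY OF CERTIFICATES (PROVED):** if for every pair `(x, q)` with `7/10 ≤ |x − q| < ρ` there is a
valid `CellCert` for the NEGATED priced weight `z ↦ −pricedTerm c x q z` at range `R` with `bound ≤ Λ`, then `FinPricedLoadCap ρ c Λ R`.
(In practice ONE rational table in the frame `x = 0`, `q = a·e₃` transported by isometries; `dist`, `forceTerm` are isometry-invariant.) -/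
theorem finPricedLoadCap_of_certs {ρ c Λ R : ℝ}
    (h : ∀ x q : E3, (7 : ℝ) / 10 ≤ dist x q → dist x q < ρ →
      ∃ C : CellCert, C.Valid x q R (fun z => -pricedTerm c x q z) ∧ C.bound ≤ Λ) :
    FinPricedLoadCap ρ c Λ R := by
  intro s x q hx hq hqx hR hsep hlt
  obtain ⟨C, hV, hb⟩ := h x q (hsep x hx q hq (Ne.symm hqx)) hlt
  have hsepT : ∀ z ∈ (s.erase x).erase q, ∀ z' ∈ (s.erase x).erase q, z ≠ z' → (7 : ℝ) / 10 ≤ dist z z' :=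
    fun z hz z' hz' hne => hsep z ((Finset.mem_erase.1 (Finset.mem_erase.1 hz).2).2) z'
      ((Finset.mem_erase.1 (Finset.mem_erase.1 hz').2).2) hne
  have hsum := C.sum_le hV ((s.erase x).erase q) (fun z hz => admissible_of_mem hx hq hR hsep hz) hsepT
  rw [Finset.sum_neg_distrib] at hsum
  linarith

/-- **THE CERTIFIED CONE OF STUB 3 (PROVED modulo `e⋆ ≤ −0.711`):** a uniform family of valid clique-cell certificates at range `5` and price
`8/125` with bounds `≤ 3.85` for the negated priced weight gives `ContactHotAbove (3/4)`. -/
theorem contactHotAbove_threeQuarters_of_certs5 (he : eStar ≤ -(711 / 1000))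
    (h : ∀ x q : E3, (7 : ℝ) / 10 ≤ dist x q → dist x q < 3 / 4 →
      ∃ C : CellCert, C.Valid x q 5 (fun z => -pricedTerm (8 / 125) x q z) ∧ C.bound ≤ 77 / 20) :
    ContactHotAbove (3 / 4) :=
  contactHotAbove_threeQuarters_of_finPriced5 he (finPricedLoadCap_of_certs h)

/-! ### §5 The two-piece path of row 343 in the same format: isotropic far load and far force certificates -/

/-- **`FinShellLoad r₁ R E`** — the ISOTROPIC far-load piece (I-CAP as ordered): every `7/10`-separated finite point set in the shell
`r₁ < |z − x| ≤ R` about `x` has `∑ |V(|z − x|)| ≤ E`.  Certified by a `CellCert` with weight `|V|` (no partner: take `q := x`, the third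
admissibility clause is then implied by the first). [TRANSFER · DECIDABLE · INSTRUMENTABLE] [line vocabulary · LoopTunnelDial contact dial · crux stmt-AtomisticToContinuum-27294 · definition, not a cited fact] -/
def FinShellLoad (r₁ R E : ℝ) : Prop :=
  ∀ (T : Finset E3) (x : E3), (∀ z ∈ T, r₁ < dist x z ∧ dist x z ≤ R) → (∀ z ∈ T, (7 : ℝ) / 10 ≤ dist x z) →
    (∀ z ∈ T, ∀ w ∈ T, z ≠ w → (7 : ℝ) / 10 ≤ dist z w) → ∑ z ∈ T, |lennardJones (dist x z)| ≤ E

/-- **`FinShellForce r₁ R F`** — the far-FORCE piece: in the same shells `∑ |g(|z − x|)| ≤ F`, `|g(r)| = |r⁻¹³ − r⁻⁷|` (direction-blind; it bounds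
`|∑ forceTerm x z e| ≤ F‖e‖`). [TRANSFER · DECIDABLE · INSTRUMENTABLE] [line vocabulary · LoopTunnelDial contact dial · crux stmt-AtomisticToContinuum-27294 · definition, not a cited fact] -/
def FinShellForce (r₁ R F : ℝ) : Prop :=
  ∀ (T : Finset E3) (x : E3), (∀ z ∈ T, r₁ < dist x z ∧ dist x z ≤ R) → (∀ z ∈ T, (7 : ℝ) / 10 ≤ dist x z) →
    (∀ z ∈ T, ∀ w ∈ T, z ≠ w → (7 : ℝ) / 10 ≤ dist z w) → ∑ z ∈ T, |(dist x z)⁻¹ ^ 13 - (dist x z)⁻¹ ^ 7| ≤ F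

/-- A shell-load certificate: a valid `CellCert` about `(x, x)` at range `R` for the weight `|V|·𝟙_{r > r₁}` bounds the shell load. -/
theorem shellLoad_le_of_cert {r₁ R : ℝ} (C : CellCert) {x : E3}
    (hV : C.Valid x x R (fun z => if r₁ < dist x z then |lennardJones (dist x z)| else 0)) (T : Finset E3)
    (hT : ∀ z ∈ T, r₁ < dist x z ∧ dist x z ≤ R) (h7 : ∀ z ∈ T, (7 : ℝ) / 10 ≤ dist x z)
    (hsep : ∀ z ∈ T, ∀ w ∈ T, z ≠ w → (7 : ℝ) / 10 ≤ dist z w) :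
    ∑ z ∈ T, |lennardJones (dist x z)| ≤ C.bound := by
  have hadm : ∀ z ∈ T, Admissible x x R z := fun z hz => ⟨h7 z hz, (hT z hz).2, h7 z hz⟩
  have h := C.sum_le hV T hadm hsep
  have heq : ∑ z ∈ T, (if r₁ < dist x z then |lennardJones (dist x z)| else 0) = ∑ z ∈ T, |lennardJones (dist x z)| :=
    Finset.sum_congr rfl fun z hz => by rw [if_pos (hT z hz).1]
  linarith

/-- `FinShellLoad` from a uniform family of shell-load certificates (PROVED). -/
theorem finShellLoad_of_certs {r₁ R E : ℝ}
    (h : ∀ x : E3, ∃ C : CellCert, C.Valid x x R (fun z => if r₁ < dist x z then |lennardJones (dist x z)| else 0) ∧ C.bound ≤ E) :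
    FinShellLoad r₁ R E := by
  intro T x hT h7 hsep
  obtain ⟨C, hV, hb⟩ := h x
  exact (shellLoad_le_of_cert C hV T hT h7 hsep).trans hb

/-- A shell-force certificate bounds the shell force sum likewise. -/
theorem shellForce_le_of_cert {r₁ R : ℝ} (C : CellCert) {x : E3}
    (hV : C.Valid x x R (fun z => if r₁ < dist x z then |(dist x z)⁻¹ ^ 13 - (dist x z)⁻¹ ^ 7| else 0)) (T : Finset E3)
    (hT : ∀ z ∈ T, r₁ < dist x z ∧ dist x z ≤ R) (h7 : ∀ z ∈ T, (7 : ℝ) / 10 ≤ dist x z)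
    (hsep : ∀ z ∈ T, ∀ w ∈ T, z ≠ w → (7 : ℝ) / 10 ≤ dist z w) :
    ∑ z ∈ T, |(dist x z)⁻¹ ^ 13 - (dist x z)⁻¹ ^ 7| ≤ C.bound := by
  have hadm : ∀ z ∈ T, Admissible x x R z := fun z hz => ⟨h7 z hz, (hT z hz).2, h7 z hz⟩
  have h := C.sum_le hV T hadm hsep
  have heq : ∑ z ∈ T, (if r₁ < dist x z then |(dist x z)⁻¹ ^ 13 - (dist x z)⁻¹ ^ 7| else 0) =
      ∑ z ∈ T, |(dist x z)⁻¹ ^ 13 - (dist x z)⁻¹ ^ 7| :=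
    Finset.sum_congr rfl fun z hz => by rw [if_pos (hT z hz).1]
  linarith

/-- `FinShellForce` from a uniform family of shell-force certificates (PROVED). -/
theorem finShellForce_of_certs {r₁ R F : ℝ}
    (h : ∀ x : E3, ∃ C : CellCert,
      C.Valid x x R (fun z => if r₁ < dist x z then |(dist x z)⁻¹ ^ 13 - (dist x z)⁻¹ ^ 7| else 0) ∧ C.bound ≤ F) :
    FinShellForce r₁ R F := by
  intro T x hT h7 hsep
  obtain ⟨C, hV, hb⟩ := h x
  exact (shellForce_le_of_cert C hV T hT h7 hsep).trans hb

/-- One force term is at most `|g(r)|·‖e‖` (Cauchy–Schwarz). -/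
theorem abs_forceTerm_le_norm {x z : E3} (hxz : x ≠ z) (e : E3) :
    |forceTerm x z e| ≤ |(dist x z)⁻¹ ^ 13 - (dist x z)⁻¹ ^ 7| * ‖e‖ := by
  have ht0 : 0 < dist x z := dist_pos.2 hxz
  have hcs : |⟪x - z, e⟫_ℝ / dist x z| ≤ ‖e‖ := by
    rw [abs_div, abs_of_pos ht0, div_le_iff₀ ht0]
    calc |⟪x - z, e⟫_ℝ| ≤ ‖x - z‖ * ‖e‖ := abs_real_inner_le_norm _ _
      _ = ‖e‖ * dist x z := by rw [dist_eq_norm, mul_comm]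
  unfold forceTerm
  rw [abs_mul]
  have hcoef : |-(1 / 12) * (12 * (dist x z)⁻¹ ^ 13 - 12 * (dist x z)⁻¹ ^ 7)| = |(dist x z)⁻¹ ^ 13 - (dist x z)⁻¹ ^ 7| := by
    rw [show -(1 / 12) * (12 * (dist x z)⁻¹ ^ 13 - 12 * (dist x z)⁻¹ ^ 7) = -((dist x z)⁻¹ ^ 13 - (dist x z)⁻¹ ^ 7) by ring,
      abs_neg]
  rw [hcoef]
  exact mul_le_mul_of_nonneg_left hcs (abs_nonneg _)

/-- The far indices beyond `r₁` that are NOT within `R₂ ≥ r₁` are the far indices beyond `R₂`. -/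
theorem farIdx_filter_not_le {r₁ R₂ : ℝ} (h : r₁ ≤ R₂) (y : Fin N → E3) (k : Fin N) :
    (farIdx r₁ y k).filter (fun m => ¬ dist (y k) (y m) ≤ R₂) = farIdx R₂ y k := by
  ext m
  simp only [farIdx, Finset.mem_filter, Finset.mem_erase, Finset.mem_univ, and_true]
  constructor
  · rintro ⟨⟨hmk, -⟩, h2⟩
    exact ⟨hmk, h2⟩
  · rintro ⟨hmk, h2⟩
    exact ⟨⟨hmk, fun h1 => h2 (h1.trans h)⟩, h2⟩

/-- **SMALL-RADIUS TAILS FROM SHELL CERTIFICATES (PROVED):** for `r₁ ≤ R₂`, the shell pieces `FinShellLoad r₁ R₂ E`, `FinShellForce r₁ R₂ F`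
and ANY certified tails `FarTails R₂ E' F'` beyond `R₂` give `FarTails r₁ (E + E') (F + F')` — the input of the tree's
`contactHot_of_finContactHot_of_farTails` at the SMALL radius `r₁` where the near part is branch-and-bound sized (row 343's two-piece path). -/
theorem farTails_of_shellCerts {r₁ R₂ E F E' F' : ℝ} (h12 : r₁ ≤ R₂) (hL : FinShellLoad r₁ R₂ E) (hF : FinShellForce r₁ R₂ F)
    (hT : FarTails R₂ E' F') : FarTails r₁ (E + E') (F + F') := by
  intro N y hy hsep k
  set mid : Finset (Fin N) := (farIdx r₁ y k).filter (fun m => dist (y k) (y m) ≤ R₂) with hmid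
  have hsplit : ∀ g : Fin N → ℝ, ∑ m ∈ farIdx r₁ y k, g m = ∑ m ∈ mid, g m + ∑ m ∈ farIdx R₂ y k, g m := by
    intro g
    rw [hmid, ← farIdx_filter_not_le h12 y k, Finset.sum_filter_add_sum_filter_not]
  have hsum_image : ∀ g : E3 → ℝ, ∑ z ∈ mid.image y, g z = ∑ m ∈ mid, g (y m) :=
    fun g => Finset.sum_image (fun a _ b _ hab => hy hab)
  have hne : ∀ m ∈ mid, y k ≠ y m := by
    intro m hm hh
    exact (Finset.mem_erase.1 (Finset.mem_filter.1 (Finset.mem_filter.1 hm).1).1).1 (hy hh).symm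
  have hTin : ∀ z ∈ mid.image y, r₁ < dist (y k) z ∧ dist (y k) z ≤ R₂ := by
    intro z hz
    obtain ⟨m, hm, rfl⟩ := Finset.mem_image.1 hz
    obtain ⟨hm1, hm2⟩ := Finset.mem_filter.1 hm
    exact ⟨not_le.1 (Finset.mem_filter.1 hm1).2, hm2⟩
  have hT7 : ∀ z ∈ mid.image y, (7 : ℝ) / 10 ≤ dist (y k) z := by
    intro z hz
    obtain ⟨m, hm, rfl⟩ := Finset.mem_image.1 hz
    have hmk : m ≠ k := (Finset.mem_erase.1 (Finset.mem_filter.1 (Finset.mem_filter.1 hm).1).1).1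
    exact hsep k m hmk.symm
  have hTsep : ∀ z ∈ mid.image y, ∀ w ∈ mid.image y, z ≠ w → (7 : ℝ) / 10 ≤ dist z w := by
    intro z hz w hw hzw
    obtain ⟨m, -, rfl⟩ := Finset.mem_image.1 hz
    obtain ⟨m', -, rfl⟩ := Finset.mem_image.1 hw
    exact hsep m m' (fun hh => hzw (congrArg y hh))
  have hTk := hT N y hy hsep k
  constructor
  · rw [hsplit]
    have h1 := hL (mid.image y) (y k) hTin hT7 hTsep
    rw [hsum_image (fun z => |lennardJones (dist (y k) z)|)] at h1
    linarith [hTk.1]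
  · intro e
    rw [hsplit]
    have h1 := hF (mid.image y) (y k) hTin hT7 hTsep
    rw [hsum_image (fun z => |(dist (y k) z)⁻¹ ^ 13 - (dist (y k) z)⁻¹ ^ 7|)] at h1
    have hmidF : |∑ m ∈ mid, forceTerm (y k) (y m) e| ≤ F * ‖e‖ := by
      calc |∑ m ∈ mid, forceTerm (y k) (y m) e| ≤ ∑ m ∈ mid, |forceTerm (y k) (y m) e| := Finset.abs_sum_le_sum_abs _ _
        _ ≤ ∑ m ∈ mid, |(dist (y k) (y m))⁻¹ ^ 13 - (dist (y k) (y m))⁻¹ ^ 7| * ‖e‖ :=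
            Finset.sum_le_sum (fun m hm => abs_forceTerm_le_norm (hne m hm) e)
        _ = (∑ m ∈ mid, |(dist (y k) (y m))⁻¹ ^ 13 - (dist (y k) (y m))⁻¹ ^ 7|) * ‖e‖ := by rw [Finset.sum_mul]
        _ ≤ F * ‖e‖ := mul_le_mul_of_nonneg_right h1 (norm_nonneg _)
    have h2 := abs_add_le (∑ m ∈ mid, forceTerm (y k) (y m) e) (∑ m ∈ farIdx R₂ y k, forceTerm (y k) (y m) e)
    have h3 := hTk.2 e
    linarith

/-- **THE TWO-PIECE PATH OF ROW 343, COMPOSED (PROVED modulo `e⋆ ≤ −0.711`):** a NEAR finite-range contact law at a small radius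
`r₁ ∈ [3/4, n]` (branch-and-bound sized) with floor `β` and force residual `F + (n⁻¹ + n⁻⁷)τₙ`, a far LOAD certificate `FinShellLoad r₁ n E`
(I-CAP, TAG 129) and a far FORCE certificate `FinShellForce r₁ n F` on the shells `r₁ < r ≤ n`, with `β − E − τₙ/6 > −0.711`, give
`ContactHotAbove (3/4)` (`n = 5`: `τ₅/6 < 0.2`, force tail `< 0.25`). -/
theorem contactHotAbove_threeQuarters_of_near_shellCerts (he : eStar ≤ -(711 / 1000)) {r₁ β E F : ℝ} {n : ℕ} (hn : 2 ≤ n)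
    (hr0 : 3 / 4 ≤ r₁) (hrn : r₁ ≤ n)
    (hN : FinContactHot (3 / 4) β r₁ (F + (((n : ℝ))⁻¹ + ((n : ℝ))⁻¹ ^ 7) * tauShell n))
    (hL : FinShellLoad r₁ n E) (hF : FinShellForce r₁ n F) (hβ : -(711 / 1000) + E + 1 / 6 * tauShell n < β) :
    ContactHotAbove (3 / 4) := by
  have hT := farTails_of_shellCerts hrn hL hF (farTails_shells hn)
  have hN' : FinContactHot (3 / 4) ((β - (E + 1 / 6 * tauShell n)) + (E + 1 / 6 * tauShell n)) r₁
      (F + (((n : ℝ))⁻¹ + ((n : ℝ))⁻¹ ^ 7) * tauShell n) := by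
    rw [sub_add_cancel]; exact hN
  exact ⟨β - (E + 1 / 6 * tauShell n), by linarith,
    contactHot_of_finContactHot_of_farTails (by linarith) hr0 hT hN'⟩

end Summit.AtomisticToContinuum.Crystallization.Theorems.LoopTunnelDialForcePricing
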